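import Mathlib
import Summits.Ventures.PercRepro2.HCov
import Summits.Ventures.PercRepro2.HCovSwap
import Summits.Ventures.PercRepro2.ContractDefs
import Summits.Ventures.PercRepro2.RECMReduction
import Summits.Ventures.PercRepro2.GcTransport
import Summits.Ventures.PercRepro2.PendantRootAll

/-!
# The leaf-root reduction of (HCOV) (blind cell PercRepro2, p5 g24; `proofs/P5-OEDGE.md` §30)

The degree-one-root contraction `HCov_pendant_root_all` in the graph vocabulary of the root-edge
reduction (`RECMReduction.lean`, `GcTransport.lean`): at a pendant root edge `e = {a₂, y}` with `y`
UNMARKED, `Gc(p[e ↦ 1]) = Gc(G/e)` (`Gc_update_one_eq_contract`, `G/e = contractRootEdge ends a₂ y`),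
so **`HCov_pendant_root_contract`**: (HCOV) on `G/e` gives (HCOV) on `G` — a reduction to a graph
with one non-loop edge fewer; **`HCov_pendant_root_contract'`** is the mirror at `a₁`.

**THE LEAF-ROOT REDUCTION** (`HCov_all_of_noUnmarkedLeafRoot`), by strong induction on `nonLoopCard`
exactly as `HCov_all_of_RECM_all`: (HCOV) for every finite weighted graph follows from (HCOV) on the
class `NoUnmarkedLeafRoot` — no root is a leaf whose only edge goes to an unmarked vertex. A minimal
counterexample to (HCOV) has both roots of degree ≥ 2 or attached to a mark.
-/

namespace Summit.Ventures.PercRepro2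

open CovForm Contract RECM CovForm.FirstOrder

namespace LeafRoot

section Contract

variable {V : Type*} {E : Type*} [Fintype E] [DecidableEq E] [Fintype V] [DecidableEq V]
  {R : Type*} [Field R] [LinearOrder R] [IsStrictOrderedRing R]

/-- **The degree-one-root contraction as a graph operation**: at a pendant root edge `e = {a₂, y}`
(the only edge at `a₂`, `y` unmarked), (HCOV) on `G/e = contractRootEdge ends a₂ y` gives (HCOV) on
`G`, at every weight of `e`. -/
theorem HCov_pendant_root_contract (p : E → R) (hp : IsProbVec p) {ends : E → Sym2 V} {e : E}
    {o a₁ a₂ a₃ b y : V} (hends : ends e = s(a₂, y)) (hleaf : ∀ f, a₂ ∈ ends f → f = e)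
    (hy : Unmarked o a₁ a₂ a₃ b y) (ho : o ≠ a₂) (h1 : a₁ ≠ a₂) (h3 : a₃ ≠ a₂) (hb : b ≠ a₂)
    (h : HCov p (contractRootEdge ends a₂ y) o a₁ a₂ a₃ b) : HCov p ends o a₁ a₂ a₃ b := by
  apply HCov_pendant_root_all hp hleaf hends ho h1 h3 hb
  have hy' : Unmarked o a₂ a₁ a₃ b y := ⟨hy.1, hy.2.2.1, hy.2.1, hy.2.2.2.1, hy.2.2.2.2⟩
  have key := Gc_update_one_eq_contract p hends hy' ho h1.symm h3.symm hb
  unfold HCov at h ⊢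
  rw [← Gc_swap, key, Gc_swap]
  exact h

/-- The mirror at the root `a₁`: a pendant root edge `e = {a₁, y}`, `y` unmarked. -/
theorem HCov_pendant_root_contract' (p : E → R) (hp : IsProbVec p) {ends : E → Sym2 V} {e : E}
    {o a₁ a₂ a₃ b y : V} (hends : ends e = s(a₁, y)) (hleaf : ∀ f, a₁ ∈ ends f → f = e)
    (hy : Unmarked o a₁ a₂ a₃ b y) (ho : o ≠ a₁) (h2 : a₂ ≠ a₁) (h3 : a₃ ≠ a₁) (hb : b ≠ a₁)
    (h : HCov p (contractRootEdge ends a₁ y) o a₁ a₂ a₃ b) : HCov p ends o a₁ a₂ a₃ b := by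
  apply HCov_pendant_root_all' hp hleaf hends ho h2 h3 hb
  have key := Gc_update_one_eq_contract p hends hy ho h2.symm h3.symm hb
  unfold HCov at h ⊢
  rw [key]
  exact h

end Contract

section Classes

variable {V : Type*} {E : Type*} [DecidableEq V]

/-- **The class `NoUnmarkedLeafRoot`**: no root is a leaf whose only edge reaches an unmarked vertex
(every root is of degree ≥ 2, or isolated, or its only edge goes to a mark). -/
def NoUnmarkedLeafRoot (ends : E → Sym2 V) (o a₁ a₂ a₃ b : V) : Prop :=
  ∀ (e : E) (y : V), Unmarked o a₁ a₂ a₃ b y →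
    ¬ (ends e = s(a₁, y) ∧ ∀ f, a₁ ∈ ends f → f = e) ∧
    ¬ (ends e = s(a₂, y) ∧ ∀ f, a₂ ∈ ends f → f = e)

end Classes

section Closure

variable (R : Type*) [Field R] [LinearOrder R] [IsStrictOrderedRing R]

/-- **(HCOV) on the class `NoUnmarkedLeafRoot`**: (HCOV) for every finite graph with distinct marks
and admissible weights in which no root is a leaf at an unmarked vertex. -/
def HCovNL_all : Prop :=
  ∀ (V E : Type) [Fintype V] [DecidableEq V] [Fintype E] [DecidableEq E]
    (ends : E → Sym2 V) (p : E → R), IsProbVec p →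
    ∀ o a₁ a₂ a₃ b : V, a₁ ≠ a₂ → a₁ ≠ a₃ → a₂ ≠ a₃ → o ≠ a₁ → o ≠ a₂ → o ≠ a₃ → o ≠ b →
      b ≠ a₁ → b ≠ a₂ → b ≠ a₃ → NoUnmarkedLeafRoot ends o a₁ a₂ a₃ b → HCov p ends o a₁ a₂ a₃ b

end Closure

section Main

variable {R : Type*} [Field R] [LinearOrder R] [IsStrictOrderedRing R]

/-- **The leaf-root reduction, by strong induction on the number of non-loop edges**: (HCOV) for every
graph on the types `V, E` from (HCOV) on the class `NoUnmarkedLeafRoot`. -/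
theorem HCov_of_noUnmarkedLeafRoot {V E : Type} [Fintype V] [DecidableEq V] [Fintype E]
    [DecidableEq E] (hB : HCovNL_all R) (n : ℕ) :
    ∀ (ends : E → Sym2 V), nonLoopCard ends = n → ∀ (p : E → R), IsProbVec p →
      ∀ o a₁ a₂ a₃ b : V, a₁ ≠ a₂ → a₁ ≠ a₃ → a₂ ≠ a₃ → o ≠ a₁ → o ≠ a₂ → o ≠ a₃ → o ≠ b →
        b ≠ a₁ → b ≠ a₂ → b ≠ a₃ → HCov p ends o a₁ a₂ a₃ b := by
  induction n using Nat.strong_induction_on with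
  | _ n ih =>
  intro ends hn p hp o a₁ a₂ a₃ b h12 h13 h23 ho1 ho2 ho3 hob hb1 hb2 hb3
  by_cases h1 : ∃ (e : E) (y : V), Unmarked o a₁ a₂ a₃ b y ∧
      (ends e = s(a₁, y) ∧ ∀ f, a₁ ∈ ends f → f = e)
  · -- `a₁` is a leaf at an unmarked `y`: contract its edge
    obtain ⟨e, y, hy, he, hleaf⟩ := h1
    have hlt : nonLoopCard (contractRootEdge ends a₁ y) < n :=
      hn ▸ nonLoopCard_contract_lt ends hy.2.1.symm he
    have hIH := ih _ hlt (contractRootEdge ends a₁ y) rfl p hp o a₁ a₂ a₃ b h12 h13 h23 ho1 ho2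
      ho3 hob hb1 hb2 hb3
    exact HCov_pendant_root_contract' p hp he hleaf hy ho1 h12.symm h13.symm hb1 hIH
  · by_cases h2 : ∃ (e : E) (y : V), Unmarked o a₁ a₂ a₃ b y ∧
        (ends e = s(a₂, y) ∧ ∀ f, a₂ ∈ ends f → f = e)
    · -- `a₂` is a leaf at an unmarked `y`: contract its edge
      obtain ⟨e, y, hy, he, hleaf⟩ := h2
      have hlt : nonLoopCard (contractRootEdge ends a₂ y) < n :=
        hn ▸ nonLoopCard_contract_lt ends hy.2.2.1.symm he
      have hIH := ih _ hlt (contractRootEdge ends a₂ y) rfl p hp o a₁ a₂ a₃ b h12 h13 h23 ho1 ho2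
        ho3 hob hb1 hb2 hb3
      exact HCov_pendant_root_contract p hp he hleaf hy ho2 h12 h23.symm hb2 hIH
    · -- no root is a leaf at an unmarked vertex: the class
      apply hB V E ends p hp o a₁ a₂ a₃ b h12 h13 h23 ho1 ho2 ho3 hob hb1 hb2 hb3
      intro e y hy
      exact ⟨fun h => h1 ⟨e, y, hy, h⟩, fun h => h2 ⟨e, y, hy, h⟩⟩

/-- **THE LEAF-ROOT REDUCTION OF (HCOV)**: `HCovNL_all → HCov_all` — (HCOV) for every finite weighted
graph follows from (HCOV) on the graphs in which no root is a leaf at an unmarked vertex. -/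
theorem HCov_all_of_noUnmarkedLeafRoot (hB : HCovNL_all R) : HCov_all R := by
  intro V E _ _ _ _ ends p hp o a₁ a₂ a₃ b h12 h13 h23 ho1 ho2 ho3 hob hb1 hb2 hb3
  exact HCov_of_noUnmarkedLeafRoot hB _ ends rfl p hp o a₁ a₂ a₃ b h12 h13 h23 ho1 ho2 ho3 hob hb1
    hb2 hb3

end Main

end LeafRoot

end Summit.Ventures.PercRepro2
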